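import Literature.NumberTheory.GaloisCohomology.Howard2004.TransportConnectingKernelProofs
import Literature.NumberTheory.EllipticCurves.TowerSaturatedCartesianScalarProofs
import Literature.NumberTheory.EllipticCurves.ZpExtensionEisensteinDVRSetting
import HarnessLib

/-!
# Howard 2004, H.4 at the places `v ∈ Σ`: the transport `H¹(K_v̄, T) ≅ H¹(K_v, Tw T)` carries a PROPAGATED level
# condition `F_v̄ = levelCondition` onto the level condition of the TWISTED local tower (the `Fbar` identification)

Topic `NumberTheory/EllipticCurves` (theorems only; no definition, no named fact, no instance, no `sorry`). Sequel of
`Howard2004/TransportUnramified` (`transportH1` on cocycles; unramified cores), `Howard2004/TransportConnectingKernelProofs`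
(`transportH1_bijective`), `TowerSaturatedCartesianScalarProofs` (`Tower.map_levelCondition_eq`: an isomorphism of towers
identifying the cores identifies the level conditions) and `ZpExtensionEisensteinSelmerStructure` (`F_𝔮`,
`eisensteinLocalReduce`, `localMap`/`restrictMap`).

Howard, Compositio 140 (2004) §1.3 H.4 [arXiv:1202.6340 p. 7 L78–82]: «the local condition `F` is its own exact orthogonal
complement under the induced local pairing `H¹(K_v, T) × H¹(K_v̄, T) → R`», where `H¹(K_v̄, T)` is read in `H¹(K_v, Tw T)` through
the transport `cd.transportH1` (tree `DualityDatum.IsSelfOrthogonalAt`: `Fbar := (F (σ•v)).map (cd.transportH1 ρ v)`).  For the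
cell's Eisenstein setting the condition at a place `v ∈ S ∖ {v ∣ p}` (resp. `v ∣ p`) of the Selmer structure `F_𝔮` on the level
`W_k = M_k ⊗ A_{m,k}(ψ)` is the PROPAGATED condition `Tower.levelCondition red p C k` of the local tower `(H¹(K_v, W_j), red_j)_j`
with unramified (resp. strict ordinary) cores `C_j` (`eisensteinSelmerStructure_inr_of_mem_of_not_mem` / `_inr_of_mem`).  The
`hFbar`-type input of every H.4 descent at such a place (bsd-line-x10b-p1 LEAD g8's assembly split 19:48:42Z, item (F̄)) is the
identification of `Fbar` with a level condition of the TWISTED tower `(H¹(K_v, Tw W_j), red′_j)_j`.  This file proves it: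

* §1 **`ConjugationDatum.transportH1_map_localMap`** — naturality of the transport in the module: for an equivariant
  `f : T₁ → T₂`, `transport_v ∘ H¹(K_v̄, f) = H¹(K_v, Tw f) ∘ transport_v`, `Tw f := restrictMap f cd.conj` (same map, twisted
  actions; the spelling `galoisCohomology.map (localMap (restrictMap f cd.conj) (inr v)) 1` of the (M2)/(M3) bricks).
* §2 **`ConjugationDatum.map_transportH1_levelCondition_eq`** — for ANY family of discrete `Γ_K`-modules `ρ j` with equivariant
  reductions `f j : ρ (j+1) → ρ j` and ANY cores `C j ≤ H¹(K_v̄, ρ j)`: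
  `(levelCondition red p C k).map (transport_k) = levelCondition red′ p (fun j ↦ (C j).map transport_j) k`
  (`Tower.map_levelCondition_eq` along the bijections `transport_j`, §1 for the commutation).
* §3 the Eisenstein instances for `F_𝔮 = eisensteinSelmerStructure … S Φ k`:
  **`ZpExtension.map_transportH1_eisensteinSelmerStructure_eq_of_mem_of_not_mem`** (`v̄ = σ•v ∈ S`, `v̄ ∤ p`: unramified cores),
  **`…_eq_of_mem`** (`v̄ ∣ p`: ordinary cores `(Φ (σ•v) _).ordinaryCore hm j`), both with `C′_j :=` the transported cores, and
  **`…_eq_unramified_of_forall`** — when the datum's local transport matches the inertia groups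
  (`g ∈ I_{K_v} ↔ φ_v g ∈ I_{K_v̄}`, e.g. `ConjugationDatum.ofLifts`: `phi_mem_absInertia_iff`) the transported unramified cores ARE
  the unramified cores of the twists (`map_transportH1_unramifiedSubgroup_eq`), so `Fbar = levelCondition red′ p (fun j ↦
  H¹_ur(K_v, Tw W_j)) k` on the nose; `…_ofLifts` packages it for the canonical datum.
* §4 the same read on the CURVE's tower triples `W.eisensteinTowerTriple κ hm S hpS hbad L hL hLS k` (triple level `k` = tower
  level `k+1`; the `Fbar` of `DualityDatum.IsSelfOrthogonalAt (D k) (W.eisensteinTowerTriple … k).cond v`):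
  **`WeierstrassCurve.eisensteinTowerTriple_cond_map_transportH1_eq_of_mem_of_not_mem`** / **`…_eq_of_mem`** /
  **`…_eq_unramified_of_forall`**, in the literal currency `X_j = H¹(K_v, E_K[p^j] ⊗ A_{m,j}(ψ))` for all `j`
  (bsd-line-x10b-p1 LEAD g8's ruling 2026-08-28T19:04:49Z).

Cell `pub/bsd-print-x9`, shared μ-crux `MuInequalityCoherentPairOfHoward` (stub_howardInputs, `SatisfiesH.h4` at `v ∈ Σ`).
BSD is not proved by any of this.

References: [Howard2004HeegnerKolyvagin] §1.1 Def. 1.1.1–1.1.3, 1.1.10, §1.3 H.4 (arXiv:1202.6340 pp. 5–7), Def. 2.1.1 and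
Def. 3.1.2 (propagation, `F_𝔮`); [SerreGaloisCohomology1997] I §2.2, §2.4 (compatible pairs); [MilneADT2006] I §2.
-/

set_option autoImplicit false

noncomputable section

open Function NumberField IsDedekindDomain Field
open scoped NumberField ContRepresentation

/-! ## §1 Naturality of the transport in the module -/

namespace Literature.NumberTheory.GaloisCohomology.Howard2004

open Literature.NumberTheory.GaloisRepresentations Literature.NumberTheory.GaloisRepresentations.DiscreteGaloisModule
open Literature.NumberTheory.EllipticCurves

namespace ConjugationDatum

variable {K : Type} [Field K] [NumberField K] (cd : ConjugationDatum K)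
  {M₁ : Type} [AddCommGroup M₁] [TopologicalSpace M₁] [DiscreteTopology M₁]
  {M₂ : Type} [AddCommGroup M₂] [TopologicalSpace M₂] [DiscreteTopology M₂]
  (ρ₁ : DiscreteGaloisModule K M₁) (ρ₂ : DiscreteGaloisModule K M₂)
  (f : ρ₁.toContRepresentation →ⁱL ρ₂.toContRepresentation)

/-- **Naturality of the transport `H¹(K_v̄, T) → H¹(K_v, Tw T)` in `T`**: for an equivariant `f : T₁ → T₂`,
`transport_v (H¹(K_v̄, f) z) = H¹(K_v, Tw f) (transport_v z)` with `Tw f = restrictMap f cd.conj` (`f` commutes with `δ_v`; all four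
maps are pull-backs of cocycles). [cite: Howard2004HeegnerKolyvagin, §1.3 (arXiv p. 7, L44–48)] [cite: SerreGaloisCohomology1997, I §2.4 (compatible pairs)] -/
theorem transportH1_map_localMap (v : HeightOneSpectrum (𝓞 K)) (z : galoisCohomology (ρ₁.toLocal (Sum.inr (cd.σ • v))) 1) :
    cd.transportH1 ρ₂ v (galoisCohomology.map (Literature.NumberTheory.EllipticCurves.DiscreteGaloisModule.localMap f (Sum.inr (cd.σ • v))) 1 z) =
      galoisCohomology.map (Literature.NumberTheory.EllipticCurves.DiscreteGaloisModule.localMap (Literature.NumberTheory.EllipticCurves.DiscreteGaloisModule.restrictMap f cd.conj) (Sum.inr v)) 1 (cd.transportH1 ρ₁ v z) := by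
  obtain ⟨ζ, rfl⟩ := oneCocycleClass_surjective _ z
  have L := (congrArg (cd.transportH1 ρ₂ v)
      (galoisCohomology.map_oneCocycleClass_ofHom (Literature.NumberTheory.EllipticCurves.DiscreteGaloisModule.localMap f (Sum.inr (cd.σ • v))) ζ)).trans
    (cd.transportH1_oneCocycleClass ρ₂ v _)
  have R := (congrArg (galoisCohomology.map (Literature.NumberTheory.EllipticCurves.DiscreteGaloisModule.localMap (Literature.NumberTheory.EllipticCurves.DiscreteGaloisModule.restrictMap f cd.conj) (Sum.inr v)) 1)
      (cd.transportH1_oneCocycleClass ρ₁ v ζ)).trans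
    (galoisCohomology.map_oneCocycleClass_ofHom (Literature.NumberTheory.EllipticCurves.DiscreteGaloisModule.localMap (Literature.NumberTheory.EllipticCurves.DiscreteGaloisModule.restrictMap f cd.conj) (Sum.inr v)) _)
  refine L.trans (Eq.trans ?_ R.symm)
  congr 1
  refine Subtype.ext (ContinuousMap.ext fun h ↦ ?_)
  change ρ₂ (cd.δ v) (f (ζ.1 (cd.φ v h))) = f (ρ₁ (cd.δ v) (ζ.1 (cd.φ v h)))
  exact (congrArg (fun φ ↦ φ (ζ.1 (cd.φ v h))) (f.isIntertwining' (cd.δ v))).symm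

/-! ## §2 Transport of a propagated level condition -/

-- The three instance families are IMPLICIT binders (filled by unification from `ρ`): under the binder `j` instance
-- synthesis does not find the pinned instances of the Eisenstein carriers `EisensteinCoeff.Twisted p m j (M j)`.
variable {W : ℕ → Type} {_iW₁ : ∀ j, AddCommGroup (W j)} {_iW₂ : ∀ j, TopologicalSpace (W j)}
  {_iW₃ : ∀ j, DiscreteTopology (W j)} (ρ : ∀ j, DiscreteGaloisModule K (W j))
  (red : ∀ j, (ρ (j + 1)).toContRepresentation →ⁱL (ρ j).toContRepresentation)

/-- **The transport identifies propagated level conditions**: for a family of discrete `Γ_K`-modules `T_j` with equivariant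
reductions `red_j : T_{j+1} → T_j`, cores `C_j ≤ H¹(K_v̄, T_j)` and `k`,
`transport_k (levelCondition (H¹(red_j))_j p C k) = levelCondition (H¹(Tw red_j))_j p (transport_j C_j)_j k` — the two local
towers are isomorphic along the bijections `transport_j` (§1 + `transportH1_bijective` + `Tower.map_levelCondition_eq`).
[cite: Howard2004HeegnerKolyvagin, Def. 1.1.3, Def. 2.1.1 and §1.3 H.4 (arXiv pp. 5–7)] -/
theorem map_transportH1_levelCondition_eq (v : HeightOneSpectrum (𝓞 K)) (p : ℕ)
    (C : ∀ j, AddSubgroup (galoisCohomology ((ρ j).toLocal (Sum.inr (cd.σ • v))) 1)) (k : ℕ) :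
    (Tower.levelCondition (H := fun j ↦ galoisCohomology ((ρ j).toLocal (Sum.inr (cd.σ • v))) 1)
        (fun j ↦ galoisCohomology.map (Literature.NumberTheory.EllipticCurves.DiscreteGaloisModule.localMap (red j) (Sum.inr (cd.σ • v))) 1) p C k).map (cd.transportH1 (ρ k) v) =
      Tower.levelCondition (H := fun j ↦ galoisCohomology ((cd.twist (ρ j)).toLocal (Sum.inr v)) 1)
        (fun j ↦ galoisCohomology.map (Literature.NumberTheory.EllipticCurves.DiscreteGaloisModule.localMap (Literature.NumberTheory.EllipticCurves.DiscreteGaloisModule.restrictMap (red j) cd.conj) (Sum.inr v)) 1) p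
        (fun j ↦ (C j).map (cd.transportH1 (ρ j) v)) k :=
  Tower.map_levelCondition_eq (H := fun j ↦ galoisCohomology ((ρ j).toLocal (Sum.inr (cd.σ • v))) 1)
    (H' := fun j ↦ galoisCohomology ((cd.twist (ρ j)).toLocal (Sum.inr v)) 1)
    (fun j ↦ galoisCohomology.map (Literature.NumberTheory.EllipticCurves.DiscreteGaloisModule.localMap (red j) (Sum.inr (cd.σ • v))) 1)
    (fun j ↦ galoisCohomology.map (Literature.NumberTheory.EllipticCurves.DiscreteGaloisModule.localMap (Literature.NumberTheory.EllipticCurves.DiscreteGaloisModule.restrictMap (red j) cd.conj) (Sum.inr v)) 1)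
    (fun j ↦ cd.transportH1 (ρ j) v) (fun j x ↦ cd.transportH1_map_localMap (ρ (j + 1)) (ρ j) (red j) v x)
    (fun j ↦ cd.transportH1_bijective (ρ j) v) p C _ (fun _ ↦ rfl) k

/-- The same with the transported unramified cores IDENTIFIED with the unramified cores of the twists, for a datum whose local
transport matches the inertia groups at `v` (`map_transportH1_unramifiedSubgroup_eq`).
[cite: Howard2004HeegnerKolyvagin, §1.3 H.4 with Def. 1.1.1/1.1.10 (arXiv pp. 5–7)] [cite: MilneADT2006, Ch. I §2] -/
theorem map_transportH1_levelCondition_unramified_eq (v : HeightOneSpectrum (𝓞 K))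
    (hI : ∀ g, g ∈ absInertia (v.adicCompletion K) ↔ cd.φ v g ∈ absInertia ((cd.σ • v).adicCompletion K)) (p k : ℕ) :
    (Tower.levelCondition (H := fun j ↦ galoisCohomology ((ρ j).toLocal (Sum.inr (cd.σ • v))) 1)
        (fun j ↦ galoisCohomology.map (Literature.NumberTheory.EllipticCurves.DiscreteGaloisModule.localMap (red j) (Sum.inr (cd.σ • v))) 1) p
        (fun j ↦ unramifiedSubgroup (GaloisRep.toLocal (cd.σ • v) (ρ j)) 1) k).map (cd.transportH1 (ρ k) v) =
      Tower.levelCondition (H := fun j ↦ galoisCohomology ((cd.twist (ρ j)).toLocal (Sum.inr v)) 1)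
        (fun j ↦ galoisCohomology.map (Literature.NumberTheory.EllipticCurves.DiscreteGaloisModule.localMap (Literature.NumberTheory.EllipticCurves.DiscreteGaloisModule.restrictMap (red j) cd.conj) (Sum.inr v)) 1) p
        (fun j ↦ unramifiedSubgroup (GaloisRep.toLocal v (cd.twist (ρ j))) 1) k :=
  Tower.map_levelCondition_eq (H := fun j ↦ galoisCohomology ((ρ j).toLocal (Sum.inr (cd.σ • v))) 1)
    (H' := fun j ↦ galoisCohomology ((cd.twist (ρ j)).toLocal (Sum.inr v)) 1)
    (fun j ↦ galoisCohomology.map (Literature.NumberTheory.EllipticCurves.DiscreteGaloisModule.localMap (red j) (Sum.inr (cd.σ • v))) 1)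
    (fun j ↦ galoisCohomology.map (Literature.NumberTheory.EllipticCurves.DiscreteGaloisModule.localMap (Literature.NumberTheory.EllipticCurves.DiscreteGaloisModule.restrictMap (red j) cd.conj) (Sum.inr v)) 1)
    (fun j ↦ cd.transportH1 (ρ j) v) (fun j x ↦ cd.transportH1_map_localMap (ρ (j + 1)) (ρ j) (red j) v x)
    (fun j ↦ cd.transportH1_bijective (ρ j) v) p _ _ (fun j ↦ cd.map_transportH1_unramifiedSubgroup_eq (ρ j) v hI) k

end ConjugationDatum

end Literature.NumberTheory.GaloisCohomology.Howard2004

/-! ## §3 The Eisenstein instances: `Fbar` for `F_𝔮` at the places of `Σ` -/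

namespace Literature.NumberTheory.EllipticCurves.ZpExtension

open Literature.NumberTheory.GaloisRepresentations Literature.NumberTheory.GaloisRepresentations.DiscreteGaloisModule
open Literature.NumberTheory.GaloisCohomology.Howard2004

variable {K : Type} [Field K] [NumberField K] {p : ℕ} [hp : Fact p.Prime] (κ : ZpExtension K p)
  {M : ℕ → Type} [∀ k, AddCommGroup (M k)] [∀ k, TopologicalSpace (M k)] [∀ k, DiscreteTopology (M k)]
  (ρ : ∀ k, DiscreteGaloisModule K (M k))
  (t : ∀ k, (ρ (k + 1)).toContRepresentation →ⁱL (ρ k).toContRepresentation) {m : ℕ} (hm : 1 ≤ m)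
  (S : Finset (HeightOneSpectrum (𝓞 K)))
  (Φ : ∀ v : HeightOneSpectrum (𝓞 K), ((p : ℕ) : 𝓞 K) ∈ v.asIdeal → OrdinaryFiltration ρ t v)
  (cd : ConjugationDatum K) (v : HeightOneSpectrum (𝓞 K)) (k : ℕ)

/-- **`Fbar` at `v̄ = σ•v ∈ S`, `v̄ ∤ p`**: the transport of the `F_𝔮`-condition at `σ•v` (the propagated UNRAMIFIED condition) is the
level-`k` condition of the twisted local tower at `v` with the transported unramified cores:
`(F_𝔮 (σ•v)).map transport_k = levelCondition (H¹(K_v, Tw red_j))_j p (transport_j H¹_ur(K_{σ v}, W_j))_j k`.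
[cite: Howard2004HeegnerKolyvagin, §1.3 H.4 (arXiv p. 7, L78–82) with Def. 3.1.2 (F_𝔮: H¹_unr at v ∈ S, propagated)] -/
theorem map_transportH1_eisensteinSelmerStructure_eq_of_mem_of_not_mem
    (hv : ((p : ℕ) : 𝓞 K) ∉ (cd.σ • v).asIdeal) (hvS : cd.σ • v ∈ S) :
    (κ.eisensteinSelmerStructure ρ t hm S Φ k (Sum.inr (cd.σ • v))).map (cd.transportH1 (κ.eisensteinTwist (ρ k) hm k) v) =
      Tower.levelCondition (H := fun j ↦ galoisCohomology ((cd.twist (κ.eisensteinTwist (ρ j) hm j)).toLocal (Sum.inr v)) 1)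
        (fun j ↦ galoisCohomology.map
          (Literature.NumberTheory.EllipticCurves.DiscreteGaloisModule.localMap (Literature.NumberTheory.EllipticCurves.DiscreteGaloisModule.restrictMap (κ.eisensteinTwistReduce hm (Nat.le_succ j) (t j)) cd.conj) (Sum.inr v)) 1) p
        (fun j ↦ (unramifiedSubgroup (GaloisRep.toLocal (cd.σ • v) (κ.eisensteinTwist (ρ j) hm j)) 1).map
          (cd.transportH1 (κ.eisensteinTwist (ρ j) hm j) v)) k := by
  rw [κ.eisensteinSelmerStructure_inr_of_mem_of_not_mem ρ t hm S Φ k hv hvS]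
  exact cd.map_transportH1_levelCondition_eq (fun j ↦ κ.eisensteinTwist (ρ j) hm j)
    (fun j ↦ κ.eisensteinTwistReduce hm (Nat.le_succ j) (t j)) v p _ k

/-- **`Fbar` at `v̄ = σ•v ∣ p`**: the transport of the `F_𝔮`-condition at `σ•v` (the propagated STRICT-ORDINARY condition) is the
level-`k` condition of the twisted local tower at `v` with the transported ordinary cores.
[cite: Howard2004HeegnerKolyvagin, §1.3 H.4 (arXiv p. 7, L78–82) with Def. 3.1.2 (F_𝔮: H¹_ord at v ∣ p, propagated)] -/
theorem map_transportH1_eisensteinSelmerStructure_eq_of_mem (hv : ((p : ℕ) : 𝓞 K) ∈ (cd.σ • v).asIdeal) :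
    (κ.eisensteinSelmerStructure ρ t hm S Φ k (Sum.inr (cd.σ • v))).map (cd.transportH1 (κ.eisensteinTwist (ρ k) hm k) v) =
      Tower.levelCondition (H := fun j ↦ galoisCohomology ((cd.twist (κ.eisensteinTwist (ρ j) hm j)).toLocal (Sum.inr v)) 1)
        (fun j ↦ galoisCohomology.map
          (Literature.NumberTheory.EllipticCurves.DiscreteGaloisModule.localMap (Literature.NumberTheory.EllipticCurves.DiscreteGaloisModule.restrictMap (κ.eisensteinTwistReduce hm (Nat.le_succ j) (t j)) cd.conj) (Sum.inr v)) 1) p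
        (fun j ↦ ((Φ (cd.σ • v) hv).ordinaryCore hm j).map (cd.transportH1 (κ.eisensteinTwist (ρ j) hm j) v)) k := by
  rw [κ.eisensteinSelmerStructure_inr_of_mem ρ t hm S Φ k hv]
  exact cd.map_transportH1_levelCondition_eq (fun j ↦ κ.eisensteinTwist (ρ j) hm j)
    (fun j ↦ κ.eisensteinTwistReduce hm (Nat.le_succ j) (t j)) v p _ k

/-- **`Fbar` at `v̄ = σ•v ∈ S`, `v̄ ∤ p`, with the unramified cores of the twists ON THE NOSE**, for a datum whose local transport at `v`
matches the inertia groups (`g ∈ I_{K_v} ↔ φ_v g ∈ I_{K_v̄}`; e.g. `ConjugationDatum.ofLifts`, `phi_mem_absInertia_iff`):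
`(F_𝔮 (σ•v)).map transport_k = levelCondition (H¹(K_v, Tw red_j))_j p (H¹_ur(K_v, Tw W_j))_j k`.
[cite: Howard2004HeegnerKolyvagin, §1.3 H.4 with Def. 1.1.10 and Def. 3.1.2 (arXiv pp. 5–7, 15)] [cite: MilneADT2006, Ch. I §2] -/
theorem map_transportH1_eisensteinSelmerStructure_eq_unramified_of_forall
    (hI : ∀ g, g ∈ absInertia (v.adicCompletion K) ↔ cd.φ v g ∈ absInertia ((cd.σ • v).adicCompletion K))
    (hv : ((p : ℕ) : 𝓞 K) ∉ (cd.σ • v).asIdeal) (hvS : cd.σ • v ∈ S) :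
    (κ.eisensteinSelmerStructure ρ t hm S Φ k (Sum.inr (cd.σ • v))).map (cd.transportH1 (κ.eisensteinTwist (ρ k) hm k) v) =
      Tower.levelCondition (H := fun j ↦ galoisCohomology ((cd.twist (κ.eisensteinTwist (ρ j) hm j)).toLocal (Sum.inr v)) 1)
        (fun j ↦ galoisCohomology.map
          (Literature.NumberTheory.EllipticCurves.DiscreteGaloisModule.localMap (Literature.NumberTheory.EllipticCurves.DiscreteGaloisModule.restrictMap (κ.eisensteinTwistReduce hm (Nat.le_succ j) (t j)) cd.conj) (Sum.inr v)) 1) p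
        (fun j ↦ unramifiedSubgroup (GaloisRep.toLocal v (cd.twist (κ.eisensteinTwist (ρ j) hm j))) 1) k := by
  rw [κ.eisensteinSelmerStructure_inr_of_mem_of_not_mem ρ t hm S Φ k hv hvS]
  exact cd.map_transportH1_levelCondition_unramified_eq (fun j ↦ κ.eisensteinTwist (ρ j) hm j)
    (fun j ↦ κ.eisensteinTwistReduce hm (Nat.le_succ j) (t j)) v hI p k

/-- **`Fbar` for the CANONICAL datum `ofLifts`** (conjugation by a lift `τ` of an involution `σ` of `K`): at `σ•v ∈ S`, `σ•v ∤ p`,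
`(F_𝔮 (σ•v)).map transport_k = levelCondition (H¹(K_v, Tw red_j))_j p (H¹_ur(K_v, Tw W_j))_j k`.
[cite: Howard2004HeegnerKolyvagin, §1.3 H.4 with Def. 1.1.10 and Def. 3.1.2 (arXiv pp. 5–7, 15)] [cite: MilneADT2006, Ch. I §2] -/
theorem map_transportH1_eisensteinSelmerStructure_eq_unramified_ofLifts (σ : K ≃ₐ[ℚ] K) (hσ₁ : σ ≠ 1) (hσ : σ * σ = 1)
    (τ : AlgebraicClosure K ≃+* AlgebraicClosure K) (hτ : IsLiftOfAut σ τ) (hτ₂ : Function.Involutive τ)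
    (hv : ((p : ℕ) : 𝓞 K) ∉ ((ConjugationDatum.ofLifts σ hσ₁ hσ τ hτ hτ₂).σ • v).asIdeal)
    (hvS : (ConjugationDatum.ofLifts σ hσ₁ hσ τ hτ hτ₂).σ • v ∈ S) :
    (κ.eisensteinSelmerStructure ρ t hm S Φ k (Sum.inr ((ConjugationDatum.ofLifts σ hσ₁ hσ τ hτ hτ₂).σ • v))).map
        ((ConjugationDatum.ofLifts σ hσ₁ hσ τ hτ hτ₂).transportH1 (κ.eisensteinTwist (ρ k) hm k) v) =
      Tower.levelCondition
        (H := fun j ↦ galoisCohomology (((ConjugationDatum.ofLifts σ hσ₁ hσ τ hτ hτ₂).twist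
          (κ.eisensteinTwist (ρ j) hm j)).toLocal (Sum.inr v)) 1)
        (fun j ↦ galoisCohomology.map (Literature.NumberTheory.EllipticCurves.DiscreteGaloisModule.localMap (Literature.NumberTheory.EllipticCurves.DiscreteGaloisModule.restrictMap (κ.eisensteinTwistReduce hm (Nat.le_succ j) (t j))
          (ConjugationDatum.ofLifts σ hσ₁ hσ τ hτ hτ₂).conj) (Sum.inr v)) 1) p
        (fun j ↦ unramifiedSubgroup (GaloisRep.toLocal v
          ((ConjugationDatum.ofLifts σ hσ₁ hσ τ hτ hτ₂).twist (κ.eisensteinTwist (ρ j) hm j))) 1) k :=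
  κ.map_transportH1_eisensteinSelmerStructure_eq_unramified_of_forall ρ t hm S Φ _ v k
    (ConjugationDatum.phi_mem_absInertia_iff hσ v) hv hvS

end Literature.NumberTheory.EllipticCurves.ZpExtension

/-! ## §4 The curve's tower triples: `Fbar` of `(W.eisensteinTowerTriple … k).cond` at the places of `S` -/

namespace WeierstrassCurve

open Literature.NumberTheory.EllipticCurves Literature.NumberTheory.GaloisRepresentations
open Literature.NumberTheory.GaloisRepresentations.DiscreteGaloisModule
open Literature.NumberTheory.GaloisCohomology Literature.NumberTheory.GaloisCohomology.Howard2004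
open Literature.NumberTheory.EllipticCurves.ZpExtension (EisensteinLevel)

variable {K : Type} [Field K] [NumberField K] (W : WeierstrassCurve ℚ) [W.IsElliptic] {p : ℕ} [hp : Fact p.Prime]
  (κ : ZpExtension K p) {m : ℕ} (hm : 1 ≤ m)
  (S : Finset (HeightOneSpectrum (𝓞 K)))
  (hpS : ∀ v : HeightOneSpectrum (𝓞 K), ((p : ℕ) : 𝓞 K) ∈ v.asIdeal → v ∈ S)
  (hbad : ∀ v : HeightOneSpectrum (𝓞 K), v ∉ S → ((p : ℕ) : 𝓞 K) ∉ v.asIdeal → (W.baseChange K).HasGoodReductionAt v)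
  (L : Set (HeightOneSpectrum (𝓞 K)))
  (hL : letI := IwasawaAlgebra.isLocalRing_quotient_X_pow_add_C p hm
    L ⊆ (W.eisensteinTower κ hm).degreeTwoPrimes p)
  (hLS : ∀ v ∈ L, v ∉ S)
  (cd : ConjugationDatum K) (k : ℕ) (v : HeightOneSpectrum (𝓞 K))

/-- **`Fbar` of the curve's tower triple at `v̄ = σ•v ∈ S`, `v̄ ∤ p`** (triple level `k`, torsion level `k+1`): the transport of
`F_𝔮 (σ•v)` is the level-`(k+1)` condition of the twisted local tower `(H¹(K_v, Tw(E_K[p^j] ⊗ A_{m,j}(ψ))), H¹(Tw red_j))_j` with the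
transported unramified cores. [cite: Howard2004HeegnerKolyvagin, §1.3 H.4 (arXiv p. 7, L78–82) with Def. 3.1.2] -/
theorem eisensteinTowerTriple_cond_map_transportH1_eq_of_mem_of_not_mem
    (hv : ((p : ℕ) : 𝓞 K) ∉ (cd.σ • v).asIdeal) (hvS : cd.σ • v ∈ S) :
    letI := IwasawaAlgebra.isLocalRing_quotient_X_pow_add_C p hm
    ((W.eisensteinTowerTriple κ hm S hpS hbad L hL hLS k).cond (Sum.inr (cd.σ • v))).map
        (cd.transportH1 ((W.eisensteinTower κ hm).ρ k) v) =
      Tower.levelCondition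
        (H := fun j ↦ galoisCohomology ((cd.twist
          (κ.eisensteinTwist ((W.baseChange K).torsionGaloisModule ((p : ℤ) ^ j)) hm j)).toLocal (Sum.inr v)) 1)
        (fun j ↦ galoisCohomology.map (Literature.NumberTheory.EllipticCurves.DiscreteGaloisModule.localMap
          (Literature.NumberTheory.EllipticCurves.DiscreteGaloisModule.restrictMap
            (κ.eisensteinTwistReduce hm (Nat.le_succ j) ((W.baseChange K).torsionGaloisModuleReduce p j)) cd.conj)
          (Sum.inr v)) 1) p
        (fun j ↦ (unramifiedSubgroup (GaloisRep.toLocal (cd.σ • v)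
            (κ.eisensteinTwist ((W.baseChange K).torsionGaloisModule ((p : ℤ) ^ j)) hm j)) 1).map
          (cd.transportH1 (κ.eisensteinTwist ((W.baseChange K).torsionGaloisModule ((p : ℤ) ^ j)) hm j) v)) (k + 1) := by
  letI := IwasawaAlgebra.isLocalRing_quotient_X_pow_add_C p hm
  -- `have`/`exact` on the CLOSED instance: the defeq `(W.eisensteinTowerTriple … k).cond ≡ eisensteinSelmerStructure … (k+1)`,
  -- `(W.eisensteinTower κ hm).ρ k ≡ κ.eisensteinTwist (E_K[p^{k+1}]) hm (k+1)` (`EisensteinLevel ≡ Twisted`) is then checked by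
  -- lazy delta (an `unfold`/`rw`/`exact`-with-metavariables route times out)
  have h := κ.map_transportH1_eisensteinSelmerStructure_eq_of_mem_of_not_mem
    (fun j ↦ (W.baseChange K).torsionGaloisModule ((p : ℤ) ^ j)) (fun j ↦ (W.baseChange K).torsionGaloisModuleReduce p j) hm S
    (fun v _ ↦ (W.baseChange K).ordinaryFiltrationAt v (fun j ↦ (W.baseChange K).torsionGaloisModuleReduce p j)
      (fun _ _ ↦ rfl)) cd v (k + 1) hv hvS
  exact h

/-- **`Fbar` of the curve's tower triple at `v̄ = σ•v ∣ p`** (triple level `k`, torsion level `k+1`): the transport of `F_𝔮 (σ•v)` is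
the level-`(k+1)` condition of the twisted local tower with the transported strict-ordinary cores of `ordinaryFiltrationAt (σ•v)`.
[cite: Howard2004HeegnerKolyvagin, §1.3 H.4 (arXiv p. 7, L78–82) with Def. 3.1.2] -/
theorem eisensteinTowerTriple_cond_map_transportH1_eq_of_mem (hv : ((p : ℕ) : 𝓞 K) ∈ (cd.σ • v).asIdeal) :
    letI := IwasawaAlgebra.isLocalRing_quotient_X_pow_add_C p hm
    ((W.eisensteinTowerTriple κ hm S hpS hbad L hL hLS k).cond (Sum.inr (cd.σ • v))).map
        (cd.transportH1 ((W.eisensteinTower κ hm).ρ k) v) =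
      Tower.levelCondition
        (H := fun j ↦ galoisCohomology ((cd.twist
          (κ.eisensteinTwist ((W.baseChange K).torsionGaloisModule ((p : ℤ) ^ j)) hm j)).toLocal (Sum.inr v)) 1)
        (fun j ↦ galoisCohomology.map (Literature.NumberTheory.EllipticCurves.DiscreteGaloisModule.localMap
          (Literature.NumberTheory.EllipticCurves.DiscreteGaloisModule.restrictMap
            (κ.eisensteinTwistReduce hm (Nat.le_succ j) ((W.baseChange K).torsionGaloisModuleReduce p j)) cd.conj)
          (Sum.inr v)) 1) p
        (fun j ↦ (((W.baseChange K).ordinaryFiltrationAt (cd.σ • v)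
            (fun j ↦ (W.baseChange K).torsionGaloisModuleReduce p j) (fun _ _ ↦ rfl)).ordinaryCore hm j).map
          (cd.transportH1 (κ.eisensteinTwist ((W.baseChange K).torsionGaloisModule ((p : ℤ) ^ j)) hm j) v)) (k + 1) := by
  letI := IwasawaAlgebra.isLocalRing_quotient_X_pow_add_C p hm
  -- `have`/`exact` on the CLOSED instance: the defeq `(W.eisensteinTowerTriple … k).cond ≡ eisensteinSelmerStructure … (k+1)`,
  -- `(W.eisensteinTower κ hm).ρ k ≡ κ.eisensteinTwist (E_K[p^{k+1}]) hm (k+1)` (`EisensteinLevel ≡ Twisted`) is then checked by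
  -- lazy delta (an `unfold`/`rw`/`exact`-with-metavariables route times out)
  have h := κ.map_transportH1_eisensteinSelmerStructure_eq_of_mem
    (fun j ↦ (W.baseChange K).torsionGaloisModule ((p : ℤ) ^ j)) (fun j ↦ (W.baseChange K).torsionGaloisModuleReduce p j) hm S
    (fun v _ ↦ (W.baseChange K).ordinaryFiltrationAt v (fun j ↦ (W.baseChange K).torsionGaloisModuleReduce p j)
      (fun _ _ ↦ rfl)) cd v (k + 1) hv
  exact h

/-- **`Fbar` of the curve's tower triple at `v̄ = σ•v ∈ S`, `v̄ ∤ p`, with the unramified cores of the twists ON THE NOSE** (datum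
matching the inertia groups at `v`, e.g. `ofLifts` via `phi_mem_absInertia_iff`).
[cite: Howard2004HeegnerKolyvagin, §1.3 H.4 with Def. 1.1.10 and Def. 3.1.2 (arXiv pp. 5–7, 15)] [cite: MilneADT2006, Ch. I §2] -/
theorem eisensteinTowerTriple_cond_map_transportH1_eq_unramified_of_forall
    (hI : ∀ g, g ∈ absInertia (v.adicCompletion K) ↔ cd.φ v g ∈ absInertia ((cd.σ • v).adicCompletion K))
    (hv : ((p : ℕ) : 𝓞 K) ∉ (cd.σ • v).asIdeal) (hvS : cd.σ • v ∈ S) :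
    letI := IwasawaAlgebra.isLocalRing_quotient_X_pow_add_C p hm
    ((W.eisensteinTowerTriple κ hm S hpS hbad L hL hLS k).cond (Sum.inr (cd.σ • v))).map
        (cd.transportH1 ((W.eisensteinTower κ hm).ρ k) v) =
      Tower.levelCondition
        (H := fun j ↦ galoisCohomology ((cd.twist
          (κ.eisensteinTwist ((W.baseChange K).torsionGaloisModule ((p : ℤ) ^ j)) hm j)).toLocal (Sum.inr v)) 1)
        (fun j ↦ galoisCohomology.map (Literature.NumberTheory.EllipticCurves.DiscreteGaloisModule.localMap
          (Literature.NumberTheory.EllipticCurves.DiscreteGaloisModule.restrictMap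
            (κ.eisensteinTwistReduce hm (Nat.le_succ j) ((W.baseChange K).torsionGaloisModuleReduce p j)) cd.conj)
          (Sum.inr v)) 1) p
        (fun j ↦ unramifiedSubgroup (GaloisRep.toLocal v
          (cd.twist (κ.eisensteinTwist ((W.baseChange K).torsionGaloisModule ((p : ℤ) ^ j)) hm j))) 1) (k + 1) := by
  letI := IwasawaAlgebra.isLocalRing_quotient_X_pow_add_C p hm
  -- `have`/`exact` on the CLOSED instance: the defeq `(W.eisensteinTowerTriple … k).cond ≡ eisensteinSelmerStructure … (k+1)`,
  -- `(W.eisensteinTower κ hm).ρ k ≡ κ.eisensteinTwist (E_K[p^{k+1}]) hm (k+1)` (`EisensteinLevel ≡ Twisted`) is then checked by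
  -- lazy delta (an `unfold`/`rw`/`exact`-with-metavariables route times out)
  have h := κ.map_transportH1_eisensteinSelmerStructure_eq_unramified_of_forall
    (fun j ↦ (W.baseChange K).torsionGaloisModule ((p : ℤ) ^ j)) (fun j ↦ (W.baseChange K).torsionGaloisModuleReduce p j) hm S
    (fun v _ ↦ (W.baseChange K).ordinaryFiltrationAt v (fun j ↦ (W.baseChange K).torsionGaloisModuleReduce p j)
      (fun _ _ ↦ rfl)) cd v (k + 1) hI hv hvS
  exact h

end WeierstrassCurve

end
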